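import Literature.Geometry.Riemannian.PinchingEstimatesODE
import Literature.Geometry.Riemannian.CurvatureDecompositionProofs
import Mathlib.LinearAlgebra.CrossProduct
import HarnessLib

/-!
# Hamilton's pinching estimates: the algebraic corollaries 1.5 and 1.8 (Hamilton 1997, §2.1), proved
(topic `Geometry/Riemannian`)

Third layer of the decomposition of `Literature.Geometry.Riemannian.hamilton_chenZhu_pinching`
(`PinchingEstimates.lean`), over the ODE-level facts of `PinchingEstimatesODE.lean`. Hamilton's
chain of invariant sets (Thms. 1.2–1.9, 2.1, 2.3) is glued by two purely algebraic corollaries,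
which are PROVED here in the variational language of the tree (no spectral theorem: unit
vectors of `ℝ³` are completed to orthonormal bases with the cross product, and
`uᵀAu + vᵀAv + wᵀAw = tr A`, `sum_quadratic_eq_trace_of_orthonormal`):

* `HamiltonODE.maxLEPairSum_of_estimates` — **Cor. 1.5** (p. 9): if `a₁ + a₂ ≥ m > 0`,
  `c₁ + c₂ ≥ m`, `(b₂+b₃)² ≤ Λ(a₁+a₂)(c₁+c₂)`, `a₂+a₃ ≤ Φ(a₁+a₂)`, `c₂+c₃ ≤ Φ(c₁+c₂)`,
  `tr A = tr C` and `Φ ≥ Λ + 1`, then `max(a₃, b₃, c₃) ≤ Ξ(a₁+a₂)` and `≤ Ξ(c₁+c₂)` with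
  `Ξ = Φ + 1` (printed proof: `a₃ ≤ a₂ + a₃` since `a₂ > 0`; `c₃ ≤ tr C = tr A ≤ (1+Φ)(a₁+a₂)`;
  `b₃ ≤ b₂ + b₃ ≤ √(ΛΦ)(a₁+a₂)` using `c₁ + c₂ ≤ ⅔ tr C = ⅔ tr A ≤ a₂ + a₃`).
* `HamiltonODE.pinchedBy_of_estimates` — **Cor. 1.8** (p. 12): if moreover `a₃ ≤ Ψ(a₁+ρ)`,
  `c₃ ≤ Ψ(c₁+ρ)` and `a₁ + ρ > 0`, `c₁ + ρ > 0` (`ρ ≥ 0`), then (2.1)–(2.2) hold,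
  `Matrix.PinchedBy A B C ρ Ω`, with `Ω = Ξ(Ψ + 1)` (Hamilton writes `Ω = ΞΨ`; the printed
  one-line argument "`a₂ ≤ a₃ ≤ Ψ(a₁+ρ)`" gives `a₁ + a₂ ≤ (Ψ+1)(a₁+ρ)`, whence `Ξ(Ψ+1)`).

The companion `PinchingEstimatesInitialFit.lean` shows that the estimates hold at `t = 0` for
suitable constants.

## References

* R. S. Hamilton, *Four-manifolds with positive isotropic curvature*, Comm. Anal. Geom. 5 (1997)
  1–92, §2.1, Cor. 1.5 (pp. 9–10), Cor. 1.8 (p. 12).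
  [Hamilton1997]
-/

noncomputable section

open Set Real
open scoped Matrix

namespace Literature.Geometry.Riemannian

namespace HamiltonODE

/-! ### Orthonormal completion in `ℝ³` and small identities -/

section LinearAlgebra

variable (A B : Matrix (Fin 3) (Fin 3) ℝ)

/-- `uᵀB(-v) = -uᵀBv`. [folklore] -/
theorem dotProduct_mulVec_neg (u v : Fin 3 → ℝ) : u ⬝ᵥ (B *ᵥ (-v)) = -(u ⬝ᵥ (B *ᵥ v)) := by
  rw [Matrix.mulVec_neg, dotProduct_neg]

/-- Every unit vector of `ℝ³` is the first vector of an orthonormal basis. [folklore] -/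
theorem exists_orthonormal_complement {u : Fin 3 → ℝ} (hu : u ⬝ᵥ u = 1) :
    ∃ v w : Fin 3 → ℝ, v ⬝ᵥ v = 1 ∧ w ⬝ᵥ w = 1 ∧ u ⬝ᵥ v = 0 ∧ u ⬝ᵥ w = 0 ∧ v ⬝ᵥ w = 0 := by
  have hu' : u 0 ^ 2 + u 1 ^ 2 + u 2 ^ 2 = 1 := by
    simpa [dotProduct, Fin.sum_univ_three, sq] using hu
  -- a unit vector `v` orthogonal to `u`
  obtain ⟨v, hv, huv⟩ : ∃ v : Fin 3 → ℝ, v ⬝ᵥ v = 1 ∧ u ⬝ᵥ v = 0 := by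
    by_cases h : u 1 ^ 2 + u 2 ^ 2 = 0
    · refine ⟨![0, 1, 0], by simp [dotProduct, Fin.sum_univ_three], ?_⟩
      have h1 : u 1 = 0 := by nlinarith [sq_nonneg (u 1), sq_nonneg (u 2)]
      simp [dotProduct, Fin.sum_univ_three, h1]
    · set r := Real.sqrt (u 1 ^ 2 + u 2 ^ 2) with hr
      have hr0 : 0 < r := Real.sqrt_pos.2 (lt_of_le_of_ne (by positivity) (Ne.symm h))
      have hr2 : r ^ 2 = u 1 ^ 2 + u 2 ^ 2 := Real.sq_sqrt (by positivity)
      refine ⟨![0, -u 2 / r, u 1 / r], ?_, ?_⟩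
      · simp only [dotProduct, Fin.sum_univ_three, Matrix.cons_val_zero, Matrix.cons_val_one,
          Matrix.cons_val]
        field_simp
        nlinarith [hr2]
      · simp only [dotProduct, Fin.sum_univ_three, Matrix.cons_val_zero, Matrix.cons_val_one,
          Matrix.cons_val]
        field_simp
        ring
  refine ⟨v, u ⨯₃ v, hv, dotProduct_cross_self_of_orthonormal hu hv huv, huv,
    dot_self_cross u v, dot_cross_self u v⟩

/-- An orthonormal pair of `ℝ³` is completed to an orthonormal basis by the cross product.
[folklore] -/
theorem exists_orthonormal_third {w w' : Fin 3 → ℝ} (hw : w ⬝ᵥ w = 1) (hw' : w' ⬝ᵥ w' = 1)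
    (hww' : w ⬝ᵥ w' = 0) :
    ∃ w'' : Fin 3 → ℝ, w'' ⬝ᵥ w'' = 1 ∧ w ⬝ᵥ w'' = 0 ∧ w' ⬝ᵥ w'' = 0 :=
  ⟨w ⨯₃ w', dotProduct_cross_self_of_orthonormal hw hw' hww', dot_self_cross w w',
    dot_cross_self w w'⟩

variable {A}

/-- If `a₁ + a₂ ≥ m > 0` then every unit vector has a unit vector orthogonal to it on which the
quadratic form is positive ("`a₂ > 0`", Hamilton 1997, p. 10). [cite: Hamilton1997, §2.1, Cor. 1.5 (proof, p. 10)] -/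
theorem exists_perp_quadratic_pos {m : ℝ} (hA : A.TwoSmallestEigenvaluesSumGE m) (hm : 0 < m)
    {u : Fin 3 → ℝ} (hu : u ⬝ᵥ u = 1) :
    ∃ y : Fin 3 → ℝ, y ⬝ᵥ y = 1 ∧ u ⬝ᵥ y = 0 ∧ 0 < y ⬝ᵥ (A *ᵥ y) := by
  obtain ⟨v, w, hv, hw, huv, huw, hvw⟩ := exists_orthonormal_complement hu
  have h := hA v w hv hw hvw
  by_cases hv0 : 0 < v ⬝ᵥ (A *ᵥ v)
  · exact ⟨v, hv, huv, hv0⟩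
  · exact ⟨w, hw, huw, by linarith [not_lt.1 hv0]⟩

/-- Under `a₁ + a₂ ≥ m > 0` and `a₂ + a₃ ≤ Φ(a₁ + a₂)`: `uᵀAu < Φ (wᵀAw + w'ᵀAw')` for every
unit `u` and orthonormal `w, w'` ("`a₃ ≤ a₂ + a₃` since `a₂ > 0`", Hamilton 1997, p. 10).
[cite: Hamilton1997, §2.1, Cor. 1.5 (proof, p. 10)] -/
theorem quadratic_lt_of_twoLargest {m Φ : ℝ} (hA : A.TwoSmallestEigenvaluesSumGE m) (hm : 0 < m)
    (h14 : A.TwoLargestEigenvaluesSumLE Φ) {u w w' : Fin 3 → ℝ} (hu : u ⬝ᵥ u = 1)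
    (hw : w ⬝ᵥ w = 1) (hw' : w' ⬝ᵥ w' = 1) (hww' : w ⬝ᵥ w' = 0) :
    u ⬝ᵥ (A *ᵥ u) < Φ * (w ⬝ᵥ (A *ᵥ w) + w' ⬝ᵥ (A *ᵥ w')) := by
  obtain ⟨y, hy, huy, hypos⟩ := exists_perp_quadratic_pos hA hm hu
  have := h14 u y w w' hu hy huy hw hw' hww'
  linarith

/-- `tr A ≤ (1 + Φ)(wᵀAw + w'ᵀAw')` for orthonormal `w, w'` under the same hypotheses
("`tr A = (a₁ + a₂) + a₃ ≤ (a₁ + a₂) + (a₂ + a₃)`", Hamilton 1997, p. 10).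
[cite: Hamilton1997, §2.1, Cor. 1.5 (proof, p. 10)] -/
theorem trace_le_of_twoLargest {m Φ : ℝ} (hA : A.TwoSmallestEigenvaluesSumGE m) (hm : 0 < m)
    (h14 : A.TwoLargestEigenvaluesSumLE Φ) {w w' : Fin 3 → ℝ} (hw : w ⬝ᵥ w = 1)
    (hw' : w' ⬝ᵥ w' = 1) (hww' : w ⬝ᵥ w' = 0) :
    A.trace ≤ (1 + Φ) * (w ⬝ᵥ (A *ᵥ w) + w' ⬝ᵥ (A *ᵥ w')) := by
  obtain ⟨w'', hw'', h1, h2⟩ := exists_orthonormal_third hw hw' hww'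
  have htr := sum_quadratic_eq_trace_of_orthonormal A hw hw' hw'' hww' h1 h2
  have hlt := quadratic_lt_of_twoLargest hA hm h14 hw'' hw hw' hww'
  linarith

/-- `⅔ tr A ≤ Φ (wᵀAw + w'ᵀAw')`: among the three pair sums of an orthonormal basis one is at
least `⅔` of the trace, and each is `≤ Φ(a₁ + a₂)` ("`⅔(a₁+a₂+a₃) ≤ a₂ + a₃`", Hamilton 1997,
p. 9). [cite: Hamilton1997, §2.1, Thm. 1.4 (proof, p. 9)] -/
theorem two_thirds_trace_le {Φ : ℝ} (h14 : A.TwoLargestEigenvaluesSumLE Φ) {w w' : Fin 3 → ℝ}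
    (hw : w ⬝ᵥ w = 1) (hw' : w' ⬝ᵥ w' = 1) (hww' : w ⬝ᵥ w' = 0) :
    2 / 3 * A.trace ≤ Φ * (w ⬝ᵥ (A *ᵥ w) + w' ⬝ᵥ (A *ᵥ w')) := by
  obtain ⟨w'', hw'', h1, h2⟩ := exists_orthonormal_third hw hw' hww'
  have htr := sum_quadratic_eq_trace_of_orthonormal A hw hw' hw'' hww' h1 h2
  have p1 := h14 w w' w w' hw hw' hww' hw hw' hww'
  have p2 := h14 w w'' w w' hw hw'' h1 hw hw' hww'
  have p3 := h14 w' w'' w w' hw' hw'' h2 hw hw' hww'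
  linarith

/-- `c₁ + c₂ ≤ ⅔ tr C` in variational form: some coordinate pair `(eᵢ, eⱼ)` has
`eᵢᵀCeᵢ + eⱼᵀCeⱼ ≤ ⅔ tr C`. [folklore] -/
theorem exists_coordinatePair_le_two_thirds_trace (C : Matrix (Fin 3) (Fin 3) ℝ) :
    ∃ z z' : Fin 3 → ℝ, z ⬝ᵥ z = 1 ∧ z' ⬝ᵥ z' = 1 ∧ z ⬝ᵥ z' = 0 ∧
      z ⬝ᵥ (C *ᵥ z) + z' ⬝ᵥ (C *ᵥ z') ≤ 2 / 3 * C.trace := by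
  have e0 : ![(1 : ℝ), 0, 0] ⬝ᵥ (C *ᵥ ![1, 0, 0]) = C 0 0 := by
    simp [Matrix.mulVec, dotProduct, Fin.sum_univ_three]
  have e1 : ![(0 : ℝ), 1, 0] ⬝ᵥ (C *ᵥ ![0, 1, 0]) = C 1 1 := by
    simp [Matrix.mulVec, dotProduct, Fin.sum_univ_three]
  have e2 : ![(0 : ℝ), 0, 1] ⬝ᵥ (C *ᵥ ![0, 0, 1]) = C 2 2 := by
    simp [Matrix.mulVec, dotProduct, Fin.sum_univ_three]
  have htr : C.trace = C 0 0 + C 1 1 + C 2 2 := Matrix.trace_fin_three C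
  by_cases h01 : C 0 0 + C 1 1 ≤ 2 / 3 * C.trace
  · exact ⟨![1, 0, 0], ![0, 1, 0], by simp [dotProduct, Fin.sum_univ_three],
      by simp [dotProduct, Fin.sum_univ_three], by simp [dotProduct, Fin.sum_univ_three],
      by rwa [e0, e1]⟩
  by_cases h02 : C 0 0 + C 2 2 ≤ 2 / 3 * C.trace
  · exact ⟨![1, 0, 0], ![0, 0, 1], by simp [dotProduct, Fin.sum_univ_three],
      by simp [dotProduct, Fin.sum_univ_three], by simp [dotProduct, Fin.sum_univ_three],
      by rwa [e0, e2]⟩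
  refine ⟨![0, 1, 0], ![0, 0, 1], by simp [dotProduct, Fin.sum_univ_three],
    by simp [dotProduct, Fin.sum_univ_three], by simp [dotProduct, Fin.sum_univ_three], ?_⟩
  rw [e1, e2]
  linarith [not_le.1 h01, not_le.1 h02]

end LinearAlgebra

/-! ### The swap `(A, B, C) ↦ (C, ᵗB, A)` ("the other estimate is the same") -/

/-- Exchanging the roles of `Λ²₊` and `Λ²₋`: `(A, B, C) ↦ (C, ᵗB, A)` (reversing the
orientation of the frame does this up to signs, `blockA_frame_neg3`). [folklore] -/
def swapAC (p : Blocks) : Blocks := (p.2.2, p.2.1ᵀ, p.1)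

/-- First component of the swap. [folklore] -/
@[simp] theorem swapAC_fst (p : Blocks) : (swapAC p).1 = p.2.2 := rfl
/-- Second component of the swap. [folklore] -/
@[simp] theorem swapAC_snd_fst (p : Blocks) : (swapAC p).2.1 = p.2.1ᵀ := rfl
/-- Third component of the swap. [folklore] -/
@[simp] theorem swapAC_snd_snd (p : Blocks) : (swapAC p).2.2 = p.1 := rfl

variable {p : Blocks}

/-- Thm. 1.3's set is symmetric under the swap. [folklore] -/
theorem SingularValuesSumSqLE.swapAC {Λ : ℝ} (h : SingularValuesSumSqLE p Λ) :
    SingularValuesSumSqLE (swapAC p) Λ := by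
  intro u₁ u₂ v₁ v₂ w w' z z' hu₁ hu₂ hu hv₁ hv₂ hv hw hw' hww hz hz' hzz
  simp only [swapAC_fst, swapAC_snd_fst, swapAC_snd_snd, Matrix.dotProduct_transpose_mulVec]
  have := h v₁ v₂ u₁ u₂ z z' w w' hv₁ hv₂ hv hu₁ hu₂ hu hz hz' hzz hw hw' hww
  nlinarith [this]

/-! ### Corollary 1.5 -/

/-- One half of Cor. 1.5: the three bounds by `Ξ(a₁ + a₂)`, `Ξ = Φ + 1`.
[cite: Hamilton1997, §2.1, Cor. 1.5 (pp. 9–10)] -/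
theorem maxLE_pairSumA_of_estimates {m Λ Φ : ℝ} (hm : 0 < m) (hΛ : 0 < Λ) (hΦ : Λ + 1 ≤ Φ)
    (hA : p.1.TwoSmallestEigenvaluesSumGE m) (hC : p.2.2.TwoSmallestEigenvaluesSumGE m)
    (h13 : SingularValuesSumSqLE p Λ) (h14 : p.1.TwoLargestEigenvaluesSumLE Φ)
    (htr : p.1.trace = p.2.2.trace) {u v w w' : Fin 3 → ℝ} (hu : u ⬝ᵥ u = 1) (hv : v ⬝ᵥ v = 1)
    (hw : w ⬝ᵥ w = 1) (hw' : w' ⬝ᵥ w' = 1) (hww' : w ⬝ᵥ w' = 0) :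
    u ⬝ᵥ (p.1 *ᵥ u) ≤ (Φ + 1) * (w ⬝ᵥ (p.1 *ᵥ w) + w' ⬝ᵥ (p.1 *ᵥ w')) ∧
      u ⬝ᵥ (p.2.1 *ᵥ v) ≤ (Φ + 1) * (w ⬝ᵥ (p.1 *ᵥ w) + w' ⬝ᵥ (p.1 *ᵥ w')) ∧
      u ⬝ᵥ (p.2.2 *ᵥ u) ≤ (Φ + 1) * (w ⬝ᵥ (p.1 *ᵥ w) + w' ⬝ᵥ (p.1 *ᵥ w')) := by
  set X := w ⬝ᵥ (p.1 *ᵥ w) + w' ⬝ᵥ (p.1 *ᵥ w') with hX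
  have hXm : m ≤ X := hA w w' hw hw' hww'
  have hX0 : 0 < X := hm.trans_le hXm
  have hΦ0 : 0 ≤ Φ := by linarith
  refine ⟨?_, ?_, ?_⟩
  · -- `a₃ < Φ (a₁ + a₂) ≤ (Φ + 1)(a₁ + a₂)`
    have := quadratic_lt_of_twoLargest hA hm h14 hu hw hw' hww'
    nlinarith
  · -- `b₃ ≤ b₂ + b₃ ≤ √(Λ (a₁+a₂) Φ (a₁+a₂)) ≤ (Φ + 1)(a₁ + a₂)`
    obtain ⟨y, -, hy, -, huy, -, -⟩ := exists_orthonormal_complement hu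
    obtain ⟨y₀, -, hy₀, -, hvy₀, -, -⟩ := exists_orthonormal_complement hv
    -- choose the sign of the partner of `v` so that the extra term is nonnegative
    obtain ⟨s, hs, hvs, hys⟩ : ∃ s : Fin 3 → ℝ, s ⬝ᵥ s = 1 ∧ v ⬝ᵥ s = 0 ∧
        0 ≤ y ⬝ᵥ (p.2.1 *ᵥ s) := by
      by_cases hsgn : 0 ≤ y ⬝ᵥ (p.2.1 *ᵥ y₀)
      · exact ⟨y₀, hy₀, hvy₀, hsgn⟩
      · refine ⟨-y₀, by simpa using hy₀, by simp [hvy₀], ?_⟩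
        rw [dotProduct_mulVec_neg]
        linarith [not_le.1 hsgn]
    obtain ⟨z, z', hz, hz', hzz', hzle⟩ := exists_coordinatePair_le_two_thirds_trace p.2.2
    have hCpair : z ⬝ᵥ (p.2.2 *ᵥ z) + z' ⬝ᵥ (p.2.2 *ᵥ z') ≤ Φ * X := by
      have := two_thirds_trace_le h14 hw hw' hww'
      rw [htr] at this
      exact hzle.trans this
    have key := h13 u y v s w w' z z' hu hy huy hv hs hvs hw hw' hww' hz hz' hzz'
    have hsq : (u ⬝ᵥ (p.2.1 *ᵥ v) + y ⬝ᵥ (p.2.1 *ᵥ s)) ^ 2 ≤ ((Φ + 1) * X) ^ 2 := by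
      calc (u ⬝ᵥ (p.2.1 *ᵥ v) + y ⬝ᵥ (p.2.1 *ᵥ s)) ^ 2
          ≤ Λ * X * (z ⬝ᵥ (p.2.2 *ᵥ z) + z' ⬝ᵥ (p.2.2 *ᵥ z')) := key
        _ ≤ Λ * X * (Φ * X) := by gcongr
        _ ≤ ((Φ + 1) * X) ^ 2 := by nlinarith [mul_pos hX0 hX0]
    have hb := (abs_le_of_sq_le_sq' hsq (by positivity)).2
    by_cases hneg : u ⬝ᵥ (p.2.1 *ᵥ v) ≤ 0
    · exact hneg.trans (by positivity)
    · linarith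
  · -- `c₃ < tr C = tr A ≤ (1 + Φ)(a₁ + a₂)`
    obtain ⟨y, y', hy, hy', huy, huy', hyy'⟩ := exists_orthonormal_complement hu
    have htrC := sum_quadratic_eq_trace_of_orthonormal p.2.2 hu hy hy' huy huy' hyy'
    have hpair := hC y y' hy hy' hyy'
    have htrA := trace_le_of_twoLargest hA hm h14 hw hw' hww'
    linarith

/-- **Hamilton 1997, Cor. 1.5** (pp. 9–10: "If the above estimates hold, we can find a constant
`Ξ = Φ + 1` such that `max(a₃, b₃, c₃) ≤ Ξ(a₁ + a₂)` and `max(a₃, b₃, c₃) ≤ Ξ(c₁ + c₂)`"),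
proved in variational form: the estimates of Thms. 1.2–1.4 (`a₁ + a₂ ≥ m > 0`, `c₁ + c₂ ≥ m`,
`(b₂+b₃)² ≤ Λ(a₁+a₂)(c₁+c₂)`, `a₂+a₃ ≤ Φ(a₁+a₂)`, `c₂+c₃ ≤ Φ(c₁+c₂)`, `Φ ≥ Λ + 1`) together
with the Bianchi constraint `tr A = tr C` give `MaxLEPairSum p (Φ + 1)`.
[cite: Hamilton1997, §2.1, Cor. 1.5 (pp. 9–10)] -/
theorem maxLEPairSum_of_estimates {m Λ Φ : ℝ} (hm : 0 < m) (hΛ : 0 < Λ) (hΦ : Λ + 1 ≤ Φ)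
    (hA : p.1.TwoSmallestEigenvaluesSumGE m) (hC : p.2.2.TwoSmallestEigenvaluesSumGE m)
    (h13 : SingularValuesSumSqLE p Λ) (h14A : p.1.TwoLargestEigenvaluesSumLE Φ)
    (h14C : p.2.2.TwoLargestEigenvaluesSumLE Φ) (htr : p.1.trace = p.2.2.trace) :
    MaxLEPairSum p (Φ + 1) := by
  intro u v w w' hu hv hw hw' hww'
  refine ⟨maxLE_pairSumA_of_estimates hm hΛ hΦ hA hC h13 h14A htr hu hv hw hw' hww', ?_⟩
  -- the other estimate is the same, for the swapped triple `(C, ᵗB, A)`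
  have hs := maxLE_pairSumA_of_estimates (p := swapAC p) hm hΛ hΦ hC hA h13.swapAC h14C
    htr.symm hv hu hw hw' hww'
  have hs' := maxLE_pairSumA_of_estimates (p := swapAC p) hm hΛ hΦ hC hA h13.swapAC h14C
    htr.symm hu hv hw hw' hww'
  simp only [swapAC_fst, swapAC_snd_fst, swapAC_snd_snd, Matrix.dotProduct_transpose_mulVec] at hs hs'
  exact ⟨hs'.2.2, hs.2.1, hs'.1⟩

/-! ### Corollary 1.8 -/

/-- **Hamilton 1997, Cor. 1.8** (p. 12: "If the above estimates hold, we can find a constant `Ω`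
such that `max(a₃, b₃, c₃) ≤ Ω(a₁ + ρ)` and `max(a₃, b₃, c₃) ≤ Ω(c₁ + ρ)`. Proof. We have
`max(a₃, b₃, c₃) ≤ Ξ(a₁ + a₂)` and `a₂ ≤ a₃ ≤ Ψ(a₁ + ρ)` …"), proved in variational form with
`Ω = Ξ(Ψ + 1)`: `MaxLEPairSum p Ξ`, `a₃ ≤ Ψ(a₁+ρ)`, `c₃ ≤ Ψ(c₁+ρ)` and `a₁ + ρ > 0`,
`c₁ + ρ > 0` (`Ξ, ρ ≥ 0`) give Chen–Zhu's (2.1)–(2.2), `Matrix.PinchedBy A B C ρ (Ξ(Ψ+1))`.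
[cite: Hamilton1997, §2.1, Cor. 1.8 (p. 12)] -/
theorem pinchedBy_of_estimates {Ξ Ψ ρ : ℝ} (hΞ : 0 ≤ Ξ) (hρ : 0 ≤ ρ)
    (hMax : MaxLEPairSum p Ξ) (h17A : p.1.LargestLESmallestAdd Ψ ρ)
    (h17C : p.2.2.LargestLESmallestAdd Ψ ρ)
    (hpos : ∀ w : Fin 3 → ℝ, w ⬝ᵥ w = 1 → 0 < w ⬝ᵥ (p.1 *ᵥ w) + ρ ∧ 0 < w ⬝ᵥ (p.2.2 *ᵥ w) + ρ) :
    Matrix.PinchedBy p.1 p.2.1 p.2.2 ρ (Ξ * (Ψ + 1)) := by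
  refine ⟨hpos, fun u v w hu hv hw ↦ ?_⟩
  obtain ⟨w', -, hw', -, hww', -, -⟩ := exists_orthonormal_complement hw
  obtain ⟨⟨h1, h2, h3⟩, ⟨h4, h5, h6⟩⟩ := hMax u v w w' hu hv hw hw' hww'
  have hA' := h17A w' w hw' hw
  have hC' := h17C w' w hw' hw
  have kA : Ξ * (w ⬝ᵥ (p.1 *ᵥ w) + w' ⬝ᵥ (p.1 *ᵥ w')) ≤
      Ξ * (Ψ + 1) * (w ⬝ᵥ (p.1 *ᵥ w) + ρ) := by
    rw [mul_assoc]
    refine mul_le_mul_of_nonneg_left ?_ hΞ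
    nlinarith [(hpos w hw).1]
  have kC : Ξ * (w ⬝ᵥ (p.2.2 *ᵥ w) + w' ⬝ᵥ (p.2.2 *ᵥ w')) ≤
      Ξ * (Ψ + 1) * (w ⬝ᵥ (p.2.2 *ᵥ w) + ρ) := by
    rw [mul_assoc]
    refine mul_le_mul_of_nonneg_left ?_ hΞ
    nlinarith [(hpos w hw).2]
  exact ⟨⟨h1.trans kA, h2.trans kA, h3.trans kA⟩, ⟨h4.trans kC, h5.trans kC, h6.trans kC⟩⟩

end HamiltonODE

end Literature.Geometry.Riemannian

end
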